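import Literature.Barriers.RiemannHypothesis.TuranPartialSumsCheckStrip
import HarnessLib

/-!
# Sections of `ζ` beyond `σ = 1`: soundness of the certificate checker, III (the loop invariant)

Barrier catalogue `Literature/Barriers/RiemannHypothesis/`, continuation of
`TuranPartialSumsCheckStrip.lean`. Pure proof file (nothing is defined or asserted): lemmas on the
setting of the invariant `Inv` (`TuranPartialSumsCheckDefs.lean`) of the main loop `mainGo` of
`TuranPartialSumsCheck.lean` after `j = 1, …, n` on the state `(Bre, Bim, Lrev, Rsum, hn, hd)`:

* `Bre + i Bim = M ∑_{j ≤ n, S-smooth} a_ω(j)/j`;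
* the snapshots: `Lrev` has length `min n K` and its `i`-th entry is
  `M ∑_{j ≤ min n K − i} a_ω(j)/j`;
* `Rsum ≤ W M ∑_{r ∈ T, r ≤ n} |c_r(1)|`, `hd > 0`, and `M |c_r(1)| < hn/hd` for every free prime
  `r ≤ n` (`T = freePrimes N S`, `c_r = bigCoeff N ω r`).

Also: the setting lemmas for `K = ⌊√N⌋` (every `j ≤ K` is `S`-smooth; a free prime `r` has
`K < r`, `1 ≤ N/r ≤ K`; for `K < j ≤ N`, "no key divides `j`" iff `j` is a free prime), the radii
at `σ = 1` (`bigCoeff_one_eq`: `c_r(1) = L(⌊N/r⌋)/r`), and `inv_zero`. The step and the run are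
`TuranPartialSumsCheckStep.lean`; the verdict is `TuranPartialSumsCheckSound.lean`.

## References

* [PlattTrudgian2016] D. J. Platt, T. S. Trudgian, LMS J. Comput. Math. 19 (2016), §2.
-/

noncomputable section

namespace Literature.Barriers.RiemannHypothesis.TuranCheck

open Literature.Barriers.RiemannHypothesis Complex Finset

/-! ### The setting: a valid certificate, `K = ⌊√N⌋`, the keys `S`, the free primes `T` -/

section Setting

variable {N K : ℕ} {es : List (ℕ × ℤ × ℤ × ℕ)} (hv : Valid es)
  (hSall : ∀ p : ℕ, p.Prime → p * p ≤ N → p ∈ keySet es)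
  (hK : K * K ≤ N) (hK' : N < (K + 1) * (K + 1))
include hv hSall hK hK'

/-- Every `j ≤ K` is `S`-smooth. [folklore] -/
theorem smooth_of_le_K {j : ℕ} (hjK : j ≤ K) : j.primeFactors ⊆ keySet es := by
  have _ := hv; have _ := hK'
  intro q hq
  have hqp : q.Prime := Nat.prime_of_mem_primeFactors hq
  have hj0 : j ≠ 0 := (Nat.mem_primeFactors.1 hq).2.2
  have hqj : q ≤ j := Nat.le_of_dvd (Nat.pos_of_ne_zero hj0) (Nat.dvd_of_mem_primeFactors hq)
  refine hSall q hqp ?_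
  calc q * q ≤ K * K := Nat.mul_le_mul (hqj.trans hjK) (hqj.trans hjK)
    _ ≤ N := hK

/-- For `k ≤ K` the smooth part of `[1, k]` is everything. [folklore] -/
theorem filter_smooth_eq_of_le_K {k : ℕ} (hk : k ≤ K) :
    (Finset.Icc 1 k).filter (fun j ↦ j.primeFactors ⊆ keySet es) = Finset.Icc 1 k := by
  refine Finset.filter_true_of_mem fun j hj ↦ ?_
  exact smooth_of_le_K hv hSall hK hK' ((Finset.mem_Icc.1 hj).2.trans hk)

/-- A free prime `r` has `K < r`, `1 ≤ N / r ≤ K`. [folklore] -/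
theorem freePrime_bounds {r : ℕ} (hr : r ∈ freePrimes N (keySet es)) :
    K < r ∧ 1 ≤ N / r ∧ N / r ≤ K := by
  have _ := hv
  obtain ⟨⟨hr1, hrN⟩, hrp, hrS⟩ := mem_freePrimes.1 hr
  have hrr : N < r * r := by
    by_contra h
    exact hrS (hSall r hrp (not_lt.1 h))
  have hKr : K < r := by
    by_contra h
    push Not at h
    have : r * r ≤ K * K := Nat.mul_le_mul h h
    omega
  refine ⟨hKr, Nat.div_pos hrN (by omega), ?_⟩
  have h1 : N / r ≤ N / (K + 1) := Nat.div_le_div_left (by omega) (by omega)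
  have h2 : N / (K + 1) < K + 1 := (Nat.div_lt_iff_lt_mul (by omega)).2 hK'
  omega

/-- For `K < j ≤ N`: no key divides `j` iff `j` is a free prime. [folklore] -/
theorem noKeyDvd_iff_mem_freePrimes {j : ℕ} (hKj : K < j) (hjN : j ≤ N) :
    (∀ q ∈ es.map (·.1), ¬ q ∣ j) ↔ j ∈ freePrimes N (keySet es) := by
  have _ := hK'
  have hj2 : 2 ≤ j := by
    by_contra h
    have hj1 : j ≤ 1 := by omega
    have : K = 0 := by omega
    subst this
    omega
  constructor
  · intro hno
    have hjp : j.Prime := by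
      by_contra hnp
      have hsq := Nat.minFac_sq_le_self (by omega : 0 < j) hnp
      have hmp : j.minFac.Prime := Nat.minFac_prime (by omega)
      have hmem : j.minFac ∈ keySet es := hSall _ hmp (by nlinarith [hsq])
      exact hno _ (List.mem_toFinset.1 hmem) (Nat.minFac_dvd j)
    refine mem_freePrimes.2 ⟨⟨by omega, hjN⟩, hjp, fun hjS ↦ ?_⟩
    exact hno j (List.mem_toFinset.1 hjS) dvd_rfl
  · intro hjT q hq hqj
    obtain ⟨-, hjp, hjS⟩ := mem_freePrimes.1 hjT
    obtain ⟨e, he, rfl⟩ := List.mem_map.1 hq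
    have hqp : e.1.Prime := hv.prime e he
    have : e.1 = j := (Nat.prime_dvd_prime_iff_eq hqp hjp).1 hqj
    exact hjS (List.mem_toFinset.2 (this ▸ hq))

/-- A smooth number is not a free prime. [folklore] -/
theorem not_mem_freePrimes_of_smooth {j : ℕ} (hs : j.primeFactors ⊆ keySet es) :
    j ∉ freePrimes N (keySet es) := by
  have _ := hv; have _ := hSall; have _ := hK; have _ := hK'
  intro hjT
  obtain ⟨-, hjp, hjS⟩ := mem_freePrimes.1 hjT
  exact hjS (hs (Nat.mem_primeFactors.2 ⟨hjp, dvd_rfl, hjp.ne_zero⟩))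

end Setting

/-! ### The radii at `σ = 1` -/

/-- `c_r(1) = L(⌊N/r⌋)/r`. [folklore] -/
theorem bigCoeff_one_eq (N : ℕ) (ω : ℕ → ℂ) {r : ℕ} (hr : r ≠ 0) :
    bigCoeff N ω r 1 = (r : ℂ)⁻¹ * prefSum ω (N / r) := by
  rw [bigCoeff, prefSum, Finset.mul_sum]
  refine Finset.sum_congr rfl fun m hm ↦ ?_
  have hm0 : (m : ℂ) ≠ 0 := by exact_mod_cast (show m ≠ 0 by have := (Finset.mem_Icc.1 hm).1; omega)
  have hr0 : (r : ℂ) ≠ 0 := by exact_mod_cast hr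
  rw [ofReal_one, cpow_neg_one]
  push_cast
  field_simp

/-- `smoothSum … 1` written with inverses. [folklore] -/
theorem smoothSum_one_eq (N : ℕ) (S : Finset ℕ) (ω : ℕ → ℂ) :
    Literature.Barriers.RiemannHypothesis.smoothSum N S ω 1 =
      ∑ n ∈ (Finset.Icc 1 N).filter (fun n ↦ n.primeFactors ⊆ S), complMul ω n * (n : ℂ)⁻¹ := by
  rw [Literature.Barriers.RiemannHypothesis.smoothSum]
  refine Finset.sum_congr rfl fun n _ ↦ ?_
  rw [ofReal_one, cpow_neg_one]

/-- The norm of a Gaussian integer from `normSq`. [folklore] -/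
theorem norm_sq_eq_normSq (a b : ℤ) : ‖(a : ℂ) + (b : ℂ) * I‖ ^ 2 = (normSq a b : ℝ) := by
  rw [Complex.sq_norm, Complex.normSq_apply, normSq]
  simp only [nat_add_eq, nat_mul_eq, Nat.cast_add, Nat.cast_mul,
    add_re, intCast_re, mul_re, I_re, mul_zero, intCast_im, I_im, mul_one, sub_self, add_zero,
    add_im, mul_im, zero_add]
  rw [← sq, ← sq, ← sq, ← sq, Nat.cast_natAbs, Nat.cast_natAbs, Int.cast_abs, Int.cast_abs, sq_abs,
    sq_abs]

/-! ### The loop invariant -/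

/-- The invariant holds initially. [folklore] -/
theorem inv_zero (N W K M : ℕ) (es : List (ℕ × ℤ × ℤ × ℕ)) :
    Inv N W K M es 0 0 0 [] 0 0 1 where
  hB := by simp
  hlen := by simp
  hL i hi := by simp at hi
  hR := by
    simp only [Nat.cast_zero]
    exact mul_nonneg (by positivity) (Finset.sum_nonneg fun _ _ ↦ norm_nonneg _)
  hhd := Nat.one_pos
  hH r hr hr0 := by
    have := (mem_freePrimes.1 hr).1.1
    omega

/-- Filters along `[1, n+1]`. [folklore] -/
theorem filter_Icc_succ (P : ℕ → Prop) [DecidablePred P] (n : ℕ) :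
    (Finset.Icc 1 (n + 1)).filter P =
      if P (n + 1) then insert (n + 1) ((Finset.Icc 1 n).filter P)
      else (Finset.Icc 1 n).filter P := by
  rw [← Finset.insert_Icc_right_eq_Icc_add_one (by omega : 1 ≤ n + 1), Finset.filter_insert]

/-- The elements `≤ n + 1` of a finset versus those `≤ n`. [folklore] -/
theorem filter_le_succ (T : Finset ℕ) (n : ℕ) :
    T.filter (· ≤ n + 1) =
      if n + 1 ∈ T then insert (n + 1) (T.filter (· ≤ n)) else T.filter (· ≤ n) := by
  ext r
  by_cases h : n + 1 ∈ T
  · rw [if_pos h, Finset.mem_insert, Finset.mem_filter, Finset.mem_filter]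
    constructor
    · rintro ⟨hrT, hle⟩
      rcases Nat.lt_or_ge r (n + 1) with hlt | hge
      · exact Or.inr ⟨hrT, by omega⟩
      · exact Or.inl (by omega)
    · rintro (rfl | ⟨hrT, hle⟩)
      · exact ⟨h, le_rfl⟩
      · exact ⟨hrT, by omega⟩
  · rw [if_neg h, Finset.mem_filter, Finset.mem_filter]
    constructor
    · rintro ⟨hrT, hle⟩
      refine ⟨hrT, ?_⟩
      rcases Nat.lt_or_ge r (n + 1) with hlt | hge
      · omega
      · have : r = n + 1 := by omega
        subst this; exact absurd hrT h
    · rintro ⟨hrT, hle⟩; exact ⟨hrT, by omega⟩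

/-- `a² ≤ q < (a+1)²` in `ℕ` pins `√q` between `a` and `a + 1` (real form). [folklore] -/
theorem sqrt_bounds {s q : ℕ} {ρ : ℝ} (hρ : 0 ≤ ρ) (hρq : ρ ^ 2 = q) (h1 : s * s ≤ q)
    (h2 : q < (s + 1) * (s + 1)) : (s : ℝ) ≤ ρ ∧ ρ < s + 1 := by
  constructor
  · refine le_of_pow_le_pow_left₀ two_ne_zero hρ ?_
    rw [hρq]; exact_mod_cast (by simpa [sq] using h1)
  · refine lt_of_pow_lt_pow_left₀ 2 (by positivity) ?_
    rw [hρq]; exact_mod_cast (by simpa [sq] using h2)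

end Literature.Barriers.RiemannHypothesis.TuranCheck
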